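import Summits.BirchSwinnertonDyer.BirchSwinnertonDyer.Theses.PAdicOrderV2
import Literature.NumberTheory.EllipticCurves.PAdicBSD
import Literature.NumberTheory.EllipticCurves.SelmerCorankControlProofs
import Literature.NumberTheory.EllipticCurves.SelmerInftyTorsionFiniteProofs

/-!
# Crux `PAdicOrderComparisonR2` (stmt-BirchSwinnertonDyer-0489), line `Sketch` — stub BK:
# `ord_{T=0} L_p(E,T) = corank_{ℤ_p} Sel_{p^∞}(E/ℚ)` from main conjecture ∧ semisimplicity ∧ control

Registered stub `stub_order_eq_selmerCorank` of the skeleton `Cruxes/PAdicOrderComparisonR2/Lines/Sketch.lean`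
(v5). Pure bookkeeping in `ℚ_p⟦T⟧` / `Λ = ℤ_p⟦T⟧`: for `E/ℚ` (globally minimal `W`), a prime `p`, the
cyclotomic `ℤ_p`-extension `κ` with topological generator `γ`, a cusp form `f` and a Pontryagin-dual datum
`D` with Iwasawa module `X = D.X` (`T = γ - 1`) which is `Λ`-torsion, IF
* (MC) `char_Λ X = (g)` with `ι g = p^k · L_p(f, α_p, T)` in `ℚ_p⟦T⟧` for some `k ∈ ℤ`,
* (SS) `ker (T ⊗ 1)² = ker (T ⊗ 1)` on `ℚ_p ⊗_{ℤ_p} X`, and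
* (CT) `rank_{ℤ_p} X/TX = corank_{ℤ_p} Sel_{p^∞}(E/ℚ)`,
THEN `ord_{T=0} L_p = corank_{ℤ_p} Sel_{p^∞}(E/ℚ)`. Chain: `ord_T L_p = ord_T (p^k · ι g) = ord_T ι g`
(`p^k` is a unit of `ℚ_p`) `= ord_T g` (`ℤ_p ↪ ℚ_p` is injective) `= rank_{ℤ_p} X/TX` (the tree theorem
`Greenberg1999_order_charGenerator_eq_coinvariantsRank_holds`, `X` being finitely generated over `Λ` by
`SelmerDualData.module_finite_of_isCyclotomic`) `= corank` (CT). Greenberg, LNM 1716, §1 p. 65 and §4.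
-/

set_option linter.dupNamespace false

namespace Summit.BirchSwinnertonDyer.BirchSwinnertonDyer.Theorems

open Literature.NumberTheory.EllipticCurves

/-- **The `T`-order is unchanged by an injective change of coefficients**: for an injective ring map
`φ : R →+* S` and `g ∈ R⟦T⟧`, `ord_T (map φ g) = ord_T g` (coefficientwise: `[T^n] map φ g = φ([T^n] g)`
vanishes iff `[T^n] g` does). Used with `ℤ_p ↪ ℚ_p` (`iwasawaToPowerSeries`). [folklore] -/
theorem bk_order_map_of_injective {R S : Type*} [Semiring R] [Semiring S] (φ : R →+* S)
    (hφ : Function.Injective φ) (g : PowerSeries R) :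
    (PowerSeries.map φ g).order = g.order := by
  refine le_antisymm ?_ (PowerSeries.le_order_map φ)
  by_cases hg : g = 0
  · subst hg
    simp
  · have hc : PowerSeries.coeff g.order.toNat g ≠ 0 := PowerSeries.coeff_order hg
    have hc' : PowerSeries.coeff g.order.toNat (PowerSeries.map φ g) ≠ 0 := by
      rw [PowerSeries.coeff_map]
      exact fun h => hc (hφ (by rw [h, map_zero]))
    calc (PowerSeries.map φ g).order ≤ (g.order.toNat : ℕ∞) := PowerSeries.order_le _ hc'
      _ = g.order := ENat.coe_toNat (PowerSeries.order_eq_top.not.mpr hg)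

/-- **Stub BK of line `Sketch` (crux #2 `PAdicOrderComparisonR2`): `ord_{T=0} L_p = corank Sel_{p^∞}`
from (MC) ∧ (SS) ∧ (CT).** See the module docstring; `X` is finitely generated over `Λ` over the
cyclotomic tower (`SelmerDualData.module_finite_of_isCyclotomic`), so the structure-theorem identity
`ord_T g = rank_{ℤ_p} X/TX` under `T`-semisimplicity
(`Greenberg1999_order_charGenerator_eq_coinvariantsRank_holds`) applies to the generator `g` of
`char_Λ X`; `ord_T` is insensitive to `ι : Λ ↪ ℚ_p⟦T⟧` and to the unit `p^k ∈ ℚ_p`.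
[cite: GreenbergLNM1716, §1 p. 65 and §4] -/
theorem stub_order_eq_selmerCorank :
    ∀ (W : WeierstrassCurve ℚ) [W.IsElliptic] [W.IsGloballyMinimal] (p : ℕ) [Fact p.Prime]
      (κ : Literature.NumberTheory.EllipticCurves.ZpExtension ℚ p) (γ : Field.absoluteGaloisGroup ℚ),
      κ.IsCyclotomic → κ.IsTopGenerator γ →
      ∀ {N : ℕ} [NeZero N] (f : CuspForm (CongruenceSubgroup.Gamma0 N) 2)
        (D : W.SelmerDualData κ γ), D.IsTorsion →
        (∃ (g : Literature.NumberTheory.EllipticCurves.IwasawaAlgebra p) (k : ℤ),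
            D.charIdeal = Ideal.span {g} ∧
              Literature.NumberTheory.EllipticCurves.iwasawaToPowerSeries p g =
                PowerSeries.C ((p : ℚ_[p]) ^ k) *
                  Literature.NumberTheory.EllipticCurves.padicLFunction f
                    (Literature.NumberTheory.EllipticCurves.unitRoot W p : ℚ_[p])) →
        LinearMap.ker (Literature.NumberTheory.EllipticCurves.IwasawaAlgebra.mulTRat p D.X ∘ₗ
            Literature.NumberTheory.EllipticCurves.IwasawaAlgebra.mulTRat p D.X) =
          LinearMap.ker (Literature.NumberTheory.EllipticCurves.IwasawaAlgebra.mulTRat p D.X) →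
        Literature.NumberTheory.EllipticCurves.IwasawaAlgebra.coinvariantsRank p D.X = W.selmerCorank p →
          (Literature.NumberTheory.EllipticCurves.padicLFunction f
              (Literature.NumberTheory.EllipticCurves.unitRoot W p : ℚ_[p])).order = W.selmerCorank p := by
  intro W _ _ p _ κ γ hκ hγ N _ f D htors hmc hss hctrl
  obtain ⟨g, k, hg, hι⟩ := hmc
  -- `X` is finitely generated over `Λ` (cyclotomic tower) and torsion
  haveI : Module.Finite (IwasawaAlgebra p) D.X := D.module_finite_of_isCyclotomic W κ hκ hγ
  -- structure theorem under semisimplicity: `ord_T g = rank_{ℤ_p} X/TX`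
  have h1 : g.order = (IwasawaAlgebra.coinvariantsRank p D.X : ℕ∞) :=
    Greenberg1999_order_charGenerator_eq_coinvariantsRank_holds p D.X htors g hg hss
  -- `ord_T ι g = ord_T g`
  have h2 : (iwasawaToPowerSeries p g).order = g.order :=
    bk_order_map_of_injective (algebraMap ℤ_[p] ℚ_[p]) (IsFractionRing.injective ℤ_[p] ℚ_[p]) g
  -- `ord_T (p^k · L_p) = ord_T L_p`
  have hpk : IsUnit (PowerSeries.C ((p : ℚ_[p]) ^ k)) := by
    refine IsUnit.map PowerSeries.C (IsUnit.mk0 _ (zpow_ne_zero k ?_))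
    exact_mod_cast (Fact.out : p.Prime).ne_zero
  have h3 : (iwasawaToPowerSeries p g).order =
      (padicLFunction f (unitRoot W p : ℚ_[p])).order := by
    rw [hι, PowerSeries.order_mul, PowerSeries.order_zero_of_unit hpk, zero_add]
  rw [← h3, h2, h1, hctrl]

end Summit.BirchSwinnertonDyer.BirchSwinnertonDyer.Theorems
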